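import Summits.ValiantsHypothesis.ValiantsHypothesis.Theorems.GrenetZeonDualUnipotentThreeHalvesLongMassNilSpaceTopImage

/-!
# `GrenetZeon.DualUnipotentThreeHalves` (stmt-ValiantsHypothesis-24318), line `slow_core`, stub (c) `SlowCore.LongMassSlowLawInv`:
# MAX-RANK TRANSPORT (Flanders' lemma) for every linear matrix space — and for the (c)-enemy

The companion files ✓ `NilSpaceTopImage` / ✓ `NilSpaceCoorbit` (this hand) gave the transport laws of de Seguins Pazzis attached to an element
of MAXIMAL INDEX.  The classical law attached to an element of MAXIMAL RANK is Flanders' lemma (H. Flanders 1962; R. Meshulam 1985, Lemma 1;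
the opening move of the theory of spaces of bounded rank): if `A` has maximal rank in a linear space `V ≤ M_b(ℂ)`, then EVERY `B ∈ V` maps
`ker A` into `range A`.  Proof (perturbation): if `B u ∉ range A` for some `u ∈ ker A`, pick `v₁,…,v_r` with `A v_i` a basis of `range A`, a
left inverse `P` of the `b × (r+1)` matrix `[A v₁ | … | A v_r | B u]`, and `J = [v₁ | … | v_r | u]`; then `det (P (A + tB) J) = t·g(t)` with
`g(0) = 1`, so for some `t ≠ 0` the `(r+1) × (r+1)` matrix `P (A + tB) J` is invertible and `rank (A + tB) ≥ r + 1 > rank A` — contradiction.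

* ★★ `exists_mulVec_eq_of_maxRank` — FLANDERS' LEMMA: `A ∈ V` of maximal rank, `B ∈ V`, `A u = 0` ⇒ `B u = A z` for some `z`.
* ★ `ker_to_range_of_maxRank` — the same as `V·(ker A) ⊆ range A` in submodule form.
* For the (c)-enemy (a nilpotent space, where a generic element has maximal rank AND maximal index): `exists_mulVec_eq_of_maxRank_of_nil` records
  the two transports side by side — `B·ker A ⊆ range A` (rank) and `B·ker A ⊆ ker A^{H−1}` (index, ✓ `NilSpaceTopImage.top_mulVec_eq_zero_of_mulVec_eq_zero`).

HONEST FRAMING.  Support lemma (`--supports stmt-ValiantsHypothesis-24318`), a classical structural law; NOT progress on (c) (RESEARCH — OPEN); closes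
no stub; S3, 24318, 8062, `VP ≠ VNP` NOT proved.  Def-free, no named facts, no sorry.
[cite: Flanders1962, Lemma 1] [cite: Meshulam1985, Lemma 1]
-/

set_option linter.dupNamespace false
set_option autoImplicit false

noncomputable section

namespace Summit.ValiantsHypothesis.ValiantsHypothesis.Theorems.GrenetZeon.NilSpaceMaxRank

open Matrix Polynomial
open scoped BigOperators
open Summit.ValiantsHypothesis.ValiantsHypothesis.Theorems.GrenetZeon.NilSpaceSandwich (evalRingHom_mapMatrix_line)

variable {b : ℕ}

/-! ## §1 Small matrix facts -/

/-- Column `k` of a product: `(M N)_{·k} = M (N_{·k})`. -/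
theorem mul_apply_eq_mulVec_col {l m n : Type*} [Fintype m] (M : Matrix l m ℂ) (N : Matrix m n ℂ) (i : l) (k : n) :
    (M * N) i k = (M *ᵥ fun j => N j k) i := by
  simp [Matrix.mul_apply, Matrix.mulVec, dotProduct]

/-- A matrix built from columns, applied to a vector, is the corresponding combination of the columns. -/
theorem of_cols_mulVec {m : Type*} {r : ℕ} (cols : Fin r → m → ℂ) (c : Fin r → ℂ) :
    (Matrix.of fun i k => cols k i) *ᵥ c = ∑ k, c k • cols k := by
  funext i
  simp only [Matrix.mulVec, dotProduct, Matrix.of_apply, Finset.sum_apply, Pi.smul_apply, smul_eq_mul]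
  exact Finset.sum_congr rfl fun k _ => mul_comm _ _

/-- A square polynomial-free perturbation argument: if `N₀ = 1` then `t ↦ det (N₀ + t N₁)` is non-zero at some `t ≠ 0`. -/
theorem exists_ne_zero_det_ne_zero {r : ℕ} (N₀ N₁ : Matrix (Fin r) (Fin r) ℂ) (h0 : N₀ = 1) :
    ∃ t : ℂ, t ≠ 0 ∧ (N₀ + t • N₁).det ≠ 0 := by
  set g : ℂ[X] := (N₀.map Polynomial.C + (Polynomial.X : ℂ[X]) • N₁.map Polynomial.C).det with hg
  have hev : ∀ t : ℂ, g.eval t = (N₀ + t • N₁).det := by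
    intro t
    rw [hg, ← Polynomial.coe_evalRingHom, RingHom.map_det, evalRingHom_mapMatrix_line]
  have hg0 : g.eval 0 = 1 := by rw [hev, zero_smul, add_zero, h0, Matrix.det_one]
  have hXg : (Polynomial.X : ℂ[X]) * g ≠ 0 := by
    refine mul_ne_zero Polynomial.X_ne_zero fun h => ?_
    rw [h, Polynomial.eval_zero] at hg0
    exact zero_ne_one hg0
  by_contra hcon
  push Not at hcon
  apply hXg
  apply Polynomial.eq_zero_of_infinite_isRoot
  refine Set.infinite_univ.mono fun t _ => ?_
  rw [Set.mem_setOf_eq, Polynomial.IsRoot.def, Polynomial.eval_mul, Polynomial.eval_X, hev]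
  by_cases ht : t = 0
  · rw [ht, zero_mul]
  · rw [hcon t ht, mul_zero]

/-! ## §2 Flanders' lemma -/

/-- ★★ **FLANDERS' LEMMA (max-rank transport).**  In a linear space `V ≤ M_b(ℂ)`, if `A ∈ V` has maximal rank then every `B ∈ V` maps
`ker A` into `range A`: `A u = 0 ⇒ B u = A z` for some `z`. [cite: Flanders1962, Lemma 1] [cite: Meshulam1985, Lemma 1] -/
theorem exists_mulVec_eq_of_maxRank (V : Submodule ℂ (Matrix (Fin b) (Fin b) ℂ)) {A : Matrix (Fin b) (Fin b) ℂ} (hA : A ∈ V)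
    (hmax : ∀ B ∈ V, B.rank ≤ A.rank) {B : Matrix (Fin b) (Fin b) ℂ} (hB : B ∈ V) {u : Fin b → ℂ} (hu : A *ᵥ u = 0) :
    ∃ z : Fin b → ℂ, B *ᵥ u = A *ᵥ z := by
  classical
  set R : Submodule ℂ (Fin b → ℂ) := LinearMap.range (Matrix.mulVecLin A) with hR
  by_contra hcon
  push Not at hcon
  have hBu : B *ᵥ u ∉ R := by
    rintro ⟨z, hz⟩
    exact hcon z (by rw [← hz, Matrix.mulVecLin_apply])
  set r : ℕ := Module.finrank ℂ R with hr
  have hrank : A.rank = r := rfl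
  let bR := Module.finBasis ℂ R
  -- preimages of the basis vectors of `range A`
  have hv0 : ∀ i : Fin r, ∃ y : Fin b → ℂ, A *ᵥ y = (bR i : Fin b → ℂ) := fun i => by
    obtain ⟨y, hy⟩ := (bR i).2
    exact ⟨y, by rw [← hy, Matrix.mulVecLin_apply]⟩
  choose v hv using hv0
  -- the test columns `J = [v | u]` and the independent columns `Wm = [A v | B u]`
  set cols : Fin (r + 1) → Fin b → ℂ := Fin.snoc (α := fun _ => Fin b → ℂ) v u with hcols
  set wcols : Fin (r + 1) → Fin b → ℂ := Fin.snoc (α := fun _ => Fin b → ℂ) (fun i : Fin r => (bR i : Fin b → ℂ)) (B *ᵥ u) with hwcols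
  set J : Matrix (Fin b) (Fin (r + 1)) ℂ := Matrix.of fun i k => cols k i with hJ
  set Wm : Matrix (Fin b) (Fin (r + 1)) ℂ := Matrix.of fun i k => wcols k i with hWm
  -- columns of `A * J` and the last column of `B * J`
  have hAJ : ∀ k i, (A * J) i k = (Fin.snoc (α := fun _ => Fin b → ℂ) (fun i : Fin r => (bR i : Fin b → ℂ)) (0 : Fin b → ℂ) k) i := by
    intro k i
    rw [mul_apply_eq_mulVec_col]
    have e : (fun j => J j k) = cols k := by funext j; rw [hJ, Matrix.of_apply]
    rw [e, hcols]
    refine Fin.lastCases ?_ (fun j => ?_) k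
    · rw [Fin.snoc_last, Fin.snoc_last, hu]
    · rw [Fin.snoc_castSucc, Fin.snoc_castSucc, hv j]
  have hBJ : ∀ i, (B * J) i (Fin.last r) = (B *ᵥ u) i := by
    intro i
    rw [mul_apply_eq_mulVec_col]
    have e : (fun j => J j (Fin.last r)) = u := by funext j; rw [hJ, Matrix.of_apply, hcols, Fin.snoc_last]
    rw [e]
  -- `Wm` has independent columns
  have hker : LinearMap.ker (Matrix.mulVecLin Wm) = ⊥ := by
    rw [LinearMap.ker_eq_bot']
    intro c hc
    rw [Matrix.mulVecLin_apply, hWm, of_cols_mulVec, Fin.sum_univ_castSucc] at hc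
    simp only [hwcols, Fin.snoc_castSucc, Fin.snoc_last] at hc
    have hlast : c (Fin.last r) = 0 := by
      by_contra hne
      apply hBu
      have e : B *ᵥ u = -((c (Fin.last r))⁻¹ • ∑ i : Fin r, c (Fin.castSucc i) • (bR i : Fin b → ℂ)) := by
        have e1 : c (Fin.last r) • B *ᵥ u = -(∑ i : Fin r, c (Fin.castSucc i) • (bR i : Fin b → ℂ)) :=
          eq_neg_of_add_eq_zero_right hc
        rw [← smul_neg, ← e1, smul_smul, inv_mul_cancel₀ hne, one_smul]
      rw [e]
      exact R.neg_mem (R.smul_mem _ (Submodule.sum_mem _ fun i _ => R.smul_mem _ (bR i).2))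
    rw [hlast, zero_smul, add_zero] at hc
    have hc' : ∑ i : Fin r, c (Fin.castSucc i) • bR i = 0 := by
      apply Subtype.ext
      rw [Submodule.coe_sum, Submodule.coe_zero]
      simpa only [Submodule.coe_smul] using hc
    have hcs : ∀ i, c (Fin.castSucc i) = 0 := Fintype.linearIndependent_iff.mp bR.linearIndependent _ hc'
    funext k
    refine Fin.lastCases ?_ (fun i => ?_) k
    · exact hlast
    · exact hcs i
  -- a left inverse `P` of `Wm`
  obtain ⟨g, hg⟩ := LinearMap.exists_leftInverse_of_injective (Matrix.mulVecLin Wm) hker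
  set P : Matrix (Fin (r + 1)) (Fin b) ℂ := LinearMap.toMatrix' g with hP
  have hPW : P * Wm = 1 := by
    have e : LinearMap.toMatrix' (g.comp (Matrix.mulVecLin Wm)) = LinearMap.toMatrix' (LinearMap.id : (Fin (r + 1) → ℂ) →ₗ[ℂ] _) := by
      rw [hg]
    rw [LinearMap.toMatrix'_comp, LinearMap.toMatrix'_id, ← Matrix.toLin'_apply', LinearMap.toMatrix'_toLin'] at e
    rw [hP]
    exact e
  have hPw : ∀ k i, (P *ᵥ wcols k) i = (1 : Matrix (Fin (r + 1)) (Fin (r + 1)) ℂ) i k := by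
    intro k i
    have e : (fun j => Wm j k) = wcols k := by funext j; rw [hWm, Matrix.of_apply]
    rw [← hPW, mul_apply_eq_mulVec_col, e]
  -- the `(r+1) × (r+1)` test matrices
  set G₀ : Matrix (Fin (r + 1)) (Fin (r + 1)) ℂ := P * (A * J) with hG₀
  set G₁ : Matrix (Fin (r + 1)) (Fin (r + 1)) ℂ := P * (B * J) with hG₁
  have hG₀c : ∀ i (j : Fin r), G₀ i (Fin.castSucc j) = (1 : Matrix (Fin (r + 1)) (Fin (r + 1)) ℂ) i (Fin.castSucc j) := by
    intro i j
    rw [hG₀, mul_apply_eq_mulVec_col]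
    have e : (fun j' => (A * J) j' (Fin.castSucc j)) = wcols (Fin.castSucc j) := by
      funext j'
      rw [hAJ, hwcols, Fin.snoc_castSucc, Fin.snoc_castSucc]
    rw [e, hPw]
  have hG₀l : ∀ i, G₀ i (Fin.last r) = 0 := by
    intro i
    rw [hG₀, mul_apply_eq_mulVec_col]
    have e : (fun j' => (A * J) j' (Fin.last r)) = 0 := by
      funext j'
      simp only [hAJ, Fin.snoc_last, Pi.zero_apply]
    rw [e, Matrix.mulVec_zero, Pi.zero_apply]
  have hG₁l : ∀ i, G₁ i (Fin.last r) = (1 : Matrix (Fin (r + 1)) (Fin (r + 1)) ℂ) i (Fin.last r) := by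
    intro i
    rw [hG₁, mul_apply_eq_mulVec_col]
    have e : (fun j' => (B * J) j' (Fin.last r)) = wcols (Fin.last r) := by
      funext j'
      rw [hBJ, hwcols, Fin.snoc_last]
    rw [e, hPw]
  set N₀ : Matrix (Fin (r + 1)) (Fin (r + 1)) ℂ :=
    G₀.updateCol (Fin.last r) (fun i => (1 : Matrix (Fin (r + 1)) (Fin (r + 1)) ℂ) i (Fin.last r)) with hN₀
  set N₁ : Matrix (Fin (r + 1)) (Fin (r + 1)) ℂ := G₁.updateCol (Fin.last r) 0 with hN₁
  have hN₀1 : N₀ = 1 := by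
    ext i k
    rw [hN₀, Matrix.updateCol_apply]
    split_ifs with hk
    · rw [hk]
    · obtain ⟨j, rfl⟩ := Fin.exists_castSucc_eq.mpr hk
      exact hG₀c i j
  obtain ⟨t, ht0, hdet⟩ := exists_ne_zero_det_ne_zero N₀ N₁ hN₀1
  -- `P (A + tB) J = G₀ + t G₁` and its determinant is `t · det (N₀ + t N₁)`
  have hM : P * ((A + t • B) * J) = G₀ + t • G₁ := by
    rw [Matrix.add_mul, Matrix.smul_mul, Matrix.mul_add, Matrix.mul_smul, hG₀, hG₁]
  have hupd : G₀ + t • G₁ =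
      (N₀ + t • N₁).updateCol (Fin.last r) (t • fun i => (1 : Matrix (Fin (r + 1)) (Fin (r + 1)) ℂ) i (Fin.last r)) := by
    ext i k
    rw [Matrix.updateCol_apply]
    split_ifs with hk
    · rw [hk, Matrix.add_apply, Matrix.smul_apply, hG₀l, hG₁l, zero_add, Pi.smul_apply]
    · rw [Matrix.add_apply, Matrix.smul_apply, Matrix.add_apply, Matrix.smul_apply, hN₀, hN₁,
        Matrix.updateCol_ne hk, Matrix.updateCol_ne hk]
  have hself : (N₀ + t • N₁).updateCol (Fin.last r) (fun i => (1 : Matrix (Fin (r + 1)) (Fin (r + 1)) ℂ) i (Fin.last r)) =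
      N₀ + t • N₁ := by
    have e : (fun i => (1 : Matrix (Fin (r + 1)) (Fin (r + 1)) ℂ) i (Fin.last r)) = fun i => (N₀ + t • N₁) i (Fin.last r) := by
      funext i
      rw [Matrix.add_apply, Matrix.smul_apply, hN₀, hN₁, Matrix.updateCol_self, Matrix.updateCol_self, Pi.zero_apply,
        smul_zero, add_zero]
    rw [e, Matrix.updateCol_eq_self]
  have hdetM : (P * ((A + t • B) * J)).det ≠ 0 := by
    rw [hM, hupd, Matrix.det_updateCol_smul, hself]
    exact mul_ne_zero ht0 hdet
  -- rank bookkeeping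
  have hunit : IsUnit (P * ((A + t • B) * J)) :=
    (Matrix.isUnit_iff_isUnit_det _).mpr (isUnit_iff_ne_zero.mpr hdetM)
  have h1 : (P * ((A + t • B) * J)).rank = r + 1 := by
    rw [Matrix.rank_of_isUnit _ hunit, Fintype.card_fin]
  have h2 : (P * ((A + t • B) * J)).rank ≤ (A + t • B).rank :=
    (Matrix.rank_mul_le_right _ _).trans (Matrix.rank_mul_le_left _ _)
  have h3 : (A + t • B).rank ≤ A.rank := hmax _ (V.add_mem hA (V.smul_mem t hB))
  rw [h1] at h2
  rw [hrank] at h3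
  omega

/-- ★ **Flanders' lemma, submodule form**: `V·(ker A) ⊆ range A` for `A ∈ V` of maximal rank. [cite: Flanders1962, Lemma 1] -/
theorem mulVec_mem_range_of_maxRank (V : Submodule ℂ (Matrix (Fin b) (Fin b) ℂ)) {A : Matrix (Fin b) (Fin b) ℂ} (hA : A ∈ V)
    (hmax : ∀ B ∈ V, B.rank ≤ A.rank) {B : Matrix (Fin b) (Fin b) ℂ} (hB : B ∈ V) {u : Fin b → ℂ}
    (hu : u ∈ LinearMap.ker (Matrix.mulVecLin A)) : B *ᵥ u ∈ LinearMap.range (Matrix.mulVecLin A) := by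
  rw [LinearMap.mem_ker, Matrix.mulVecLin_apply] at hu
  obtain ⟨z, hz⟩ := exists_mulVec_eq_of_maxRank V hA hmax hB hu
  exact ⟨z, by rw [Matrix.mulVecLin_apply, hz]⟩

/-- ★ **Two transports at a generic element of a nilpotent space.**  In a nilpotent space `V` of uniform index `≤ H` (`1 ≤ H`), if `A ∈ V`
has maximal rank, every `B ∈ V` maps `ker A` into `range A ∩ ker A^{H−1}` (Flanders + ✓ `NilSpaceTopImage.top_mulVec_eq_zero_of_mulVec_eq_zero`).
[cite: Flanders1962, Lemma 1] -/
theorem exists_mulVec_eq_of_maxRank_of_nil (V : Submodule ℂ (Matrix (Fin b) (Fin b) ℂ)) {H : ℕ} (hV : ∀ X ∈ V, X ^ H = 0) (hH : 1 ≤ H)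
    {A : Matrix (Fin b) (Fin b) ℂ} (hA : A ∈ V) (hmax : ∀ B ∈ V, B.rank ≤ A.rank) {B : Matrix (Fin b) (Fin b) ℂ} (hB : B ∈ V)
    {u : Fin b → ℂ} (hu : A *ᵥ u = 0) :
    (∃ z : Fin b → ℂ, B *ᵥ u = A *ᵥ z) ∧ A ^ (H - 1) *ᵥ (B *ᵥ u) = 0 :=
  ⟨exists_mulVec_eq_of_maxRank V hA hmax hB hu,
    Summit.ValiantsHypothesis.ValiantsHypothesis.Theorems.GrenetZeon.NilSpaceTopImage.top_mulVec_eq_zero_of_mulVec_eq_zero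
      V hV hH hA hB hu⟩

end Summit.ValiantsHypothesis.ValiantsHypothesis.Theorems.GrenetZeon.NilSpaceMaxRank

end
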